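import Literature.NumberTheory.LFunctions.NoRealZeroCertificateReplay
import Literature.NumberTheory.LFunctions.NoRealZeroUpTo
import Literature.Barriers.RiemannHypothesis.EpsteinZetaRealZerosSmallK
import HarnessLib

/-!
# Kernel replay of the Lu–Zaman–Zhao certificates: ranges with DIRECTLY settled exceptions

Topic `Literature/NumberTheory/LFunctions`. The bridge `noExceptionalZeroUpTo_of_certifiedRange`
(`NoRealZeroCertificateReplay.lean`) turns a certified range `CertifiedRange c Q₀ Q []` — EVERY
fundamental discriminant `Q₀ < |D| ≤ Q` carries a Lu–Zaman–Zhao Table-1 certificate — into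
`NoExceptionalZeroUpTo Q c` (relative to the printed Theorem 2.1, `LuZamanZhao2026.theorem21`). A few
discriminants of the range `(23, 4·10⁵]` have certificates far too deep for a kernel table
(`D = −163` needs the primes up to `3.4·10⁷`, `D = 24` up to `8.2·10⁶`; Lu–Zaman–Zhao, §3), while
mathematics settles them outright: the tree proves `L(σ, χ) ≠ 0` on `(0, 1)` for every odd real
primitive character of conductor `4 < d ≤ 144` by the Epstein class sum
(`Literature.Barriers.RiemannHypothesis.LFunction_ne_zero_of_odd_quadratic_of_le`), and for all
conductors `≤ 23` by Fekete–Pólya positivity (`noRealZeroUpTo_twentyThree`). This file lets such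
DIRECT results discharge exceptions of a certified range:

* `NoRealZeroOddAt M` / `NoRealZeroEvenAt M` — every odd (resp. even) primitive quadratic character
  of a modulus in the list `M` has no zero in `(0, 1)`;
* `noExceptionalZeroUpTo_of_certifiedRange_except` — **the bridge with exceptions**: from
  `theorem21`, a base `NoExceptionalZeroUpTo Q₀ c`, `CertifiedRange c Q₀ Q X`, and direct results
  `NoRealZeroOddAt Mo`, `NoRealZeroEvenAt Me` covering the exceptions (`D ∈ X`, `D < 0 ⇒ |D| ∈ Mo`;
  `D > 0 ⇒ |D| ∈ Me`), conclude `NoExceptionalZeroUpTo Q c`;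
* feeders: `noRealZeroOddAt_of_le` (Epstein, moduli `4 < q ≤ 144`), `NoRealZeroUpTo.oddAt`,
  `NoRealZeroUpTo.evenAt` (a wide table), `NoRealZeroOddAt.append`, `NoRealZeroEvenAt.append`,
  `NoRealZeroOddAt.mono`, `NoRealZeroEvenAt.mono`.

Definitions and theorems only; nothing is evaluated; no named fact beyond those of the imports.

## References

* W. Lu, A. Zaman, K. Zhao, *Dirichlet L-functions of quadratic characters have no exceptional
  zeros for moduli up to 10¹⁰*, Math. Comp. (2026), arXiv:2602.03626, §2.1–§3. [LuZamanZhao2026]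
* P. T. Bateman, E. Grosswald, *On Epstein's zeta function*, Acta Arith. 9 (1964) 365–373,
  Theorem 3. [BatemanGrosswald1964]
* H. L. Montgomery, R. C. Vaughan, *Multiplicative Number Theory I*, CUP 2007, §9.3 Theorem 9.13,
  §11.2.1. [MontgomeryVaughan2007]
-/

noncomputable section

open Complex Finset

namespace Literature.NumberTheory.LFunctions
namespace LuZamanZhao2026
namespace Replay

open PrimitiveQuadratic Literature.Barriers.RiemannHypothesis

/-! ### Direct results at listed moduli -/

/-- **No real zero for the ODD real primitive characters of the listed moduli**: for every `q ∈ M`,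
every primitive quadratic odd `χ` mod `q` and every `σ ∈ (0, 1)`, `L(σ, χ) ≠ 0`.
[cite: MontgomeryVaughan2007, §11.2] -/
def NoRealZeroOddAt (M : List ℕ) : Prop :=
  ∀ (q : ℕ) [NeZero q], q ∈ M → ∀ χ : DirichletCharacter ℂ q, χ.IsQuadratic → χ.IsPrimitive → χ.Odd →
    ∀ σ : ℝ, 0 < σ → σ < 1 → χ.LFunction σ ≠ 0

/-- **No real zero for the EVEN real primitive characters of the listed moduli**: for every `q ∈ M`,
every primitive quadratic even `χ` mod `q` and every `σ ∈ (0, 1)`, `L(σ, χ) ≠ 0`.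
[cite: MontgomeryVaughan2007, §11.2] -/
def NoRealZeroEvenAt (M : List ℕ) : Prop :=
  ∀ (q : ℕ) [NeZero q], q ∈ M → ∀ χ : DirichletCharacter ℂ q, χ.IsQuadratic → χ.IsPrimitive → χ.Even →
    ∀ σ : ℝ, 0 < σ → σ < 1 → χ.LFunction σ ≠ 0

/-- Shrinking the list of moduli (odd). [cite: MontgomeryVaughan2007, §11.2] -/
theorem NoRealZeroOddAt.mono {M M' : List ℕ} (h : NoRealZeroOddAt M) (hM : ∀ q ∈ M', q ∈ M) :
    NoRealZeroOddAt M' :=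
  fun q _ hq => h q (hM q hq)

/-- Shrinking the list of moduli (even). [cite: MontgomeryVaughan2007, §11.2] -/
theorem NoRealZeroEvenAt.mono {M M' : List ℕ} (h : NoRealZeroEvenAt M) (hM : ∀ q ∈ M', q ∈ M) :
    NoRealZeroEvenAt M' :=
  fun q _ hq => h q (hM q hq)

/-- Joining two lists of moduli (odd). [cite: MontgomeryVaughan2007, §11.2] -/
theorem NoRealZeroOddAt.append {M M' : List ℕ} (h : NoRealZeroOddAt M) (h' : NoRealZeroOddAt M') :
    NoRealZeroOddAt (M ++ M') := by
  intro q _ hq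
  rcases List.mem_append.1 hq with hq | hq
  · exact h q hq
  · exact h' q hq

/-- Joining two lists of moduli (even). [cite: MontgomeryVaughan2007, §11.2] -/
theorem NoRealZeroEvenAt.append {M M' : List ℕ} (h : NoRealZeroEvenAt M) (h' : NoRealZeroEvenAt M') :
    NoRealZeroEvenAt (M ++ M') := by
  intro q _ hq
  rcases List.mem_append.1 hq with hq | hq
  · exact h q hq
  · exact h' q hq

/-- **Feeder (Epstein class sum)**: the odd characters of all moduli `4 < q ≤ 144` are settled by the
tree's theorem `LFunction_ne_zero_of_odd_quadratic_of_le` (every reduced class of discriminant `−q`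
has `k ≤ 6`, so `ζ(σ)L(σ, χ) = ½ Σ_Q Z_Q(σ) < 0` on `(0, 1)`). [cite: BatemanGrosswald1964, Theorem 3] -/
theorem noRealZeroOddAt_of_le {M : List ℕ} (hM : ∀ q ∈ M, 4 < q ∧ q ≤ 144) : NoRealZeroOddAt M := by
  intro q _ hq χ hquad hprim hodd σ hσ0 hσ1
  obtain ⟨h4, h144⟩ := hM q hq
  exact LFunction_ne_zero_of_odd_quadratic_of_le h4 h144 hprim hquad hodd hσ0 hσ1

/-- **Feeder (a wide table)**: `NoRealZeroUpTo Q` settles the odd characters of every listed modulus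
`3 ≤ q ≤ Q`. [cite: MontgomeryVaughan2007, §11.2] -/
theorem _root_.Literature.NumberTheory.LFunctions.NoRealZeroUpTo.oddAt {Q : ℕ} (h : NoRealZeroUpTo Q)
    {M : List ℕ} (hM : ∀ q ∈ M, 3 ≤ q ∧ q ≤ Q) : NoRealZeroOddAt M := by
  intro q _ hq χ hquad hprim _ σ hσ0 hσ1
  obtain ⟨h3, hQ⟩ := hM q hq
  exact h q h3 hQ χ hquad hprim σ hσ0 hσ1

/-- **Feeder (a wide table)**: `NoRealZeroUpTo Q` settles the even characters of every listed modulus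
`3 ≤ q ≤ Q`. [cite: MontgomeryVaughan2007, §11.2] -/
theorem _root_.Literature.NumberTheory.LFunctions.NoRealZeroUpTo.evenAt {Q : ℕ} (h : NoRealZeroUpTo Q)
    {M : List ℕ} (hM : ∀ q ∈ M, 3 ≤ q ∧ q ≤ Q) : NoRealZeroEvenAt M := by
  intro q _ hq χ hquad hprim _ σ hσ0 hσ1
  obtain ⟨h3, hQ⟩ := hM q hq
  exact h q h3 hQ χ hquad hprim σ hσ0 hσ1

/-! ### The bridge with exceptions -/

/-- **The bridge with directly settled exceptions.** Assume Lu–Zaman–Zhao's Theorem 2.1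
(`theorem21`, as printed), `c > 0`, a base table `NoExceptionalZeroUpTo Q₀ c`, a certified range
`(Q₀, Q]` with exception list `X`, and direct no-real-zero results for the odd characters of the moduli
`Mo` and the even characters of the moduli `Me` such that every exception `D ∈ X` is covered
(`D < 0 ⇒ |D| ∈ Mo`, `D > 0 ⇒ |D| ∈ Me`; the character of discriminant `D` is odd iff `D < 0`). Then
`NoExceptionalZeroUpTo Q c`: no primitive quadratic `L(s, χ)` of modulus `3 ≤ q ≤ Q` vanishes on
`[1 − c/log q, 1] ∩ (0, 1]`. [cite: LuZamanZhao2026, §2.1–§3] -/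
theorem noExceptionalZeroUpTo_of_certifiedRange_except (h21 : theorem21) {c : ℝ} (hc : 0 < c)
    {Q0 Q : ℕ} (h₀ : NoExceptionalZeroUpTo Q0 c) {X : List ℤ} (h : CertifiedRange c Q0 Q X)
    {Mo Me : List ℕ} (hodd : NoRealZeroOddAt Mo) (heven : NoRealZeroEvenAt Me)
    (hXo : ∀ D ∈ X, D < 0 → D.natAbs ∈ Mo) (hXe : ∀ D ∈ X, 0 < D → D.natAbs ∈ Me) :
    NoExceptionalZeroUpTo Q c := by
  intro q _ hq3 hqQ χ hquad hprim σ hσ0 hσ hσ1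
  by_cases hq₀ : q ≤ Q0
  · exact h₀ q hq3 hq₀ χ hquad hprim σ hσ0 hσ hσ1
  have hq₀' : Q0 < q := lt_of_not_ge hq₀
  have h1 : 1 < q := by omega
  -- at `σ = 1` there is nothing to do
  rcases eq_or_lt_of_le hσ1 with rfl | hlt
  · have hne : χ ≠ 1 := SiegelZeroQuality.ne_one_of_isPrimitive hprim (by omega)
    exact DirichletCharacter.LFunction_ne_zero_of_one_le_re χ (Or.inl hne) (by simp)
  obtain ⟨s, hs1, hs⟩ := exists_sign_eq χ
  have hs1' : s = 1 ∨ s = -1 := by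
    rcases hs1 with ⟨h, -⟩ | ⟨h, -⟩
    · exact Or.inl h
    · exact Or.inr h
  have hfd : IsFundamentalDiscriminant (s * q) :=
    isFundamentalDiscriminant_sign_mul hprim hquad hs hs1' h1
  have habs : |(s * q : ℤ)| = q := by
    rcases hs1' with rfl | rfl <;> simp
  have hnat : (s * q : ℤ).natAbs = q := by
    have := congrArg Int.natAbs habs
    rwa [Int.natAbs_abs, Int.natAbs_natCast] at this
  by_cases hX : (s * q : ℤ) ∈ X
  · -- a directly settled exception
    rcases hs1 with ⟨rfl, hev⟩ | ⟨rfl, hod⟩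
    · have hpos : (0 : ℤ) < 1 * q := by
        have : (0 : ℤ) < q := by exact_mod_cast (show 0 < q by omega)
        simpa using this
      have hmem := hXe _ hX hpos
      rw [hnat] at hmem
      exact heven q hmem χ hquad hprim hev σ hσ0 hlt
    · have hneg : (-1 * q : ℤ) < 0 := by
        have : (0 : ℤ) < q := by exact_mod_cast (show 0 < q by omega)
        linarith
      have hmem := hXo _ hX hneg
      rw [hnat] at hmem
      exact hodd q hmem χ hquad hprim hod σ hσ0 hlt
  · -- a certified discriminant
    obtain ⟨lam, phi, E, hrow, N, hN⟩ :=
      h (s * q) hfd (by rw [habs]; exact_mod_cast hq₀') (by rw [habs]; exact_mod_cast hqQ) hX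
    rw [hnat, ← primeSum_eq_primeSumD h1 hprim hquad hs hs1' (1 + rOf lam) N] at hN
    exact lfunction_ne_zero_of_rhs_lt_primeSum h21 hq3 hprim hquad hrow hc hN hσ0 hσ hσ1

/-- **Special case: no exceptions beyond the odd moduli `4 < q ≤ 144`** (Epstein) — the form used
when the only deep rows of a range are odd discriminants of small conductor.
[cite: LuZamanZhao2026, §2.1–§3] -/
theorem noExceptionalZeroUpTo_of_certifiedRange_oddSmall (h21 : theorem21) {c : ℝ} (hc : 0 < c)
    {Q0 Q : ℕ} (h₀ : NoExceptionalZeroUpTo Q0 c) {X : List ℤ} (h : CertifiedRange c Q0 Q X)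
    (hX : ∀ D ∈ X, D < 0 ∧ 4 < D.natAbs ∧ D.natAbs ≤ 144) : NoExceptionalZeroUpTo Q c := by
  refine noExceptionalZeroUpTo_of_certifiedRange_except h21 hc h₀ h (Mo := X.map Int.natAbs) (Me := [])
    (noRealZeroOddAt_of_le fun q hq => ?_) (fun q _ hq => by simp at hq) (fun D hD _ => ?_)
    (fun D hD hD0 => absurd (hX D hD).1 (not_lt.2 hD0.le))
  · obtain ⟨D, hD, rfl⟩ := List.mem_map.1 hq
    exact ⟨(hX D hD).2.1, (hX D hD).2.2⟩
  · exact List.mem_map.2 ⟨D, hD, rfl⟩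

end Replay
end LuZamanZhao2026
end Literature.NumberTheory.LFunctions

end
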